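import Literature.Computability.Cryptography.VanDamSeroussiCubicLaw
import Literature.Computability.Cryptography.ShorOrderFindingQuantum
import HarnessLib

/-!
# The quantum block of the cubic Gauss-sum experiment, VI: decoding the eigenvalue read-out

Topic `Literature/Computability/Cryptography`; sequel of `VanDamSeroussiCubicLaw.lean`. The control
read-out `γ` of Kitaev's circuit inside the block is decoded into a frequency `freqOf γ < N` by
Kitaev's procedure (signs of the estimated cosine and sine per level give a quadrant, halving from
the top level down gives `f/N` to precision `< 1/2N`; Kitaev 1995, §3, Lemma 10 and the Chebyshev
estimate before Lemma 9), exactly as the tree does for order finding (`ShorOrderFindingQuantum.lean`,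
whose arithmetic lemmas `trigEst_of_cnt`, `cdist_quadrantCenter_le_bool`, `chebyshev_block`,
`sum_filter_exists_le` are reused):

* the layout of the tests (`lev`, `block`, `card_block`), the counts `cnt`, the estimates
  `levelEst`, `phaseEst`, the decoded frequency `freqOf`;
* the law at frequency `f`: `wt f j b = testWeight b σ_j (2π f 2^{lev j}/N)` — the factors of
  `‖Mk f γ‖² = 4^k ∏_j wt f j (γ j)` (`norm_sq_Mk_eq_prod`);
* **`freqOf_eq`** — an `Accurate` read-out decodes to `f`; **`sum_not_accurate_le`** — inaccurate
  read-outs have weight `≤ 128 κ / B`.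

Everything here is proved; no named fact is introduced.

## References

* A. Yu. Kitaev, arXiv:quant-ph/9511026 (1995), §3 (Remark 8, before Lemma 9, Lemma 10)
  [Kitaev1995].
* W. van Dam, G. Seroussi, arXiv:quant-ph/0207131 (2002), §4 Thm. 1 [VanDamSeroussi2002].
-/

noncomputable section

namespace Literature.Computability.Cryptography

namespace VanDamSeroussi

namespace CubicBlock

open _root_.Computability Complexity QuantumComplexity Kitaev1995 Finset Real

namespace Layout

variable (Λ : Layout)

/-! ### The layout of the tests -/

/-- The level of test `j`: control `j` applies the `2^{lev j}`-th power of the shift. [cite: Kitaev1995, §3 Lemma 10] -/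
def lev (j : Fin Λ.k) : ℕ := (j : ℕ) / Λ.Bper

/-- A block of tests: a level and a kind (`true` = sine). [folklore] -/
abbrev Blk : Type := Fin Λ.kap × Bool

/-- The tests of a block. [folklore] -/
def block (β : Λ.Blk) : Finset (Fin Λ.k) := univ.filter fun j => Λ.lev j = β.1 ∧ Λ.σ j = β.2

/-- The level of a test is below `κ`. [folklore] -/
theorem lev_lt (j : Fin Λ.k) : Λ.lev j < Λ.kap := by
  unfold lev
  have hj := j.isLt
  unfold k at hj
  exact Nat.div_lt_of_lt_mul (by rw [mul_comm]; exact hj)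

/-- **A block has `B` tests**: block `(l, b)` consists of the tests `2B·l + [b]·B + i`, `i < B`. [folklore] -/
theorem card_block (hB : 0 < Λ.B) (β : Λ.Blk) : (Λ.block β).card = Λ.B := by
  obtain ⟨l, b⟩ := β
  have hBper : Λ.Bper = 2 * Λ.B := rfl
  have hBp : 0 < Λ.Bper := by omega
  set off : ℕ := if b then Λ.B else 0 with hoff
  have hoffB : off + Λ.B ≤ Λ.Bper := by rw [hoff]; split_ifs <;> omega
  have hlk : ∀ i, i < Λ.B → Λ.Bper * (l : ℕ) + (off + i) < Λ.k := fun i hi => by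
    have hl := l.isLt
    have : Λ.Bper * (l : ℕ) + Λ.Bper ≤ Λ.Bper * Λ.kap := by rw [← Nat.mul_succ]; exact Nat.mul_le_mul_left _ hl
    unfold k; rw [mul_comm Λ.kap]; omega
  have hset : Λ.block (l, b) = (Finset.range Λ.B).image fun i =>
      (⟨Λ.Bper * (l : ℕ) + (off + min i (Λ.B - 1)), hlk _ (by omega)⟩ : Fin Λ.k) := by
    ext j
    simp only [block, mem_filter, mem_univ, true_and, mem_image, mem_range, lev]
    constructor
    · rintro ⟨hl, hs⟩
      have hdm := Nat.div_add_mod (j : ℕ) Λ.Bper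
      rw [hl] at hdm
      have hmod := Nat.mod_lt (j : ℕ) hBp
      have hrange : off ≤ (j : ℕ) % Λ.Bper ∧ (j : ℕ) % Λ.Bper < off + Λ.B := by
        rw [hoff]; unfold σ at hs
        cases b <;> simp only [if_true, Bool.false_eq_true, if_false, decide_eq_false_iff_not, decide_eq_true_eq, not_le] at hs ⊢ <;>
          omega
      refine ⟨(j : ℕ) % Λ.Bper - off, by omega, Fin.ext ?_⟩
      simp only
      rw [min_eq_left (by omega)]; omega
    · rintro ⟨i, hi, rfl⟩
      have hmin : min i (Λ.B - 1) = i := min_eq_left (by omega)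
      simp only [hmin]
      constructor
      · rw [Nat.mul_add_div hBp, Nat.div_eq_of_lt (by omega), Nat.add_zero]
      · unfold σ; simp only [Nat.mul_add_mod, Nat.mod_eq_of_lt (show off + i < Λ.Bper by omega)]
        rw [hoff]; cases b
        · simp; omega
        · simp
  rw [hset, card_image_of_injOn, card_range]
  intro i hi i' hi' h
  simp only [coe_range, Set.mem_Iio] at hi hi'
  have := congrArg Fin.val h
  simp only at this
  rw [min_eq_left (by omega), min_eq_left (by omega)] at this
  omega

/-! ### The decoder -/

/-- The number of `1`s read in a block. [folklore] -/
def cnt (β : Λ.Blk) (γ : QReg Λ.k) : ℕ := ((Λ.block β).filter fun j => γ j = true).card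

/-- The quadrant estimate of level `l`. [cite: Kitaev1995, §3 Lemma 10] -/
def levelEst (γ : QReg Λ.k) (l : Fin Λ.kap) : ℚ :=
  quadrantCenter (decide (2 * Λ.cnt (l, false) γ ≤ Λ.B)) (decide (2 * Λ.cnt (l, true) γ ≤ Λ.B))

/-- The refined estimate of the eigenphase `f/N`. [cite: Kitaev1995, §3 Lemma 10] -/
def phaseEst (γ : QReg Λ.k) : ℚ := refined (fun l => if h : l < Λ.kap then Λ.levelEst γ ⟨l, h⟩ else 0) Λ.kap

/-- **The decoded frequency**: `round(N · phaseEst) mod N`. [cite: Kitaev1995, §3 Thm 1] -/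
def freqOf (γ : QReg Λ.k) : ℕ := ((round ((Λ.Nmod : ℚ) * Λ.phaseEst γ)) % (Λ.Nmod : ℤ)).toNat

/-! ### The law at a frequency -/

/-- The weight of outcome `b` of test `j` at frequency `f`: `(1 ± trig(2π f 2^{lev j}/N))/2`. [cite: Kitaev1995, §3 Remark 8] -/
def wt (f : ℕ) (j : Fin Λ.k) (b : Bool) : ℝ := testWeight b (Λ.σ j) (2 * π * f * 2 ^ Λ.lev j / Λ.Nmod)

/-- Weights are nonnegative. [folklore] -/
theorem wt_nonneg (f : ℕ) (j : Fin Λ.k) (b : Bool) : 0 ≤ Λ.wt f j b := testWeight_nonneg _ _ _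

/-- Weights of a test sum to `1`. [folklore] -/
theorem wt_false_add_true (f : ℕ) (j : Fin Λ.k) : Λ.wt f j false + Λ.wt f j true = 1 := testWeight_false_add_true _ _

/-- **The test factor is a product law**: `‖Mk f γ‖² = 4^k ∏_j wt f j (γ j)`. [cite: Kitaev1995, §3 (Remark 8, Lemma 8)] -/
theorem norm_sq_Mk_eq_prod (f : ℕ) (γ : QReg Λ.k) : ‖Λ.Mk f γ‖ ^ 2 = 4 ^ Λ.k * ∏ j, Λ.wt f j (γ j) := by
  rw [Λ.Mk_eq, norm_mul, mul_pow, norm_sq_modeAmp, Complex.norm_pow, Complex.norm_two, ← pow_mul,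
    show (2 : ℝ) ^ (Λ.k * 2) = 4 ^ Λ.k by rw [mul_comm, pow_mul]; norm_num]
  congr 1
  refine prod_congr rfl fun j _ => ?_
  rw [wt, lev]; push_cast; ring_nf

/-- The mean count of a block: `B · (1 − trig θ_l)/2`. [cite: Kitaev1995, §3 Remark 8] -/
theorem sum_wt_block (hB : 0 < Λ.B) (f : ℕ) (β : Λ.Blk) :
    ∑ j ∈ Λ.block β, Λ.wt f j true =
      Λ.B * ((1 + (-1) * (if β.2 then Real.sin (2 * π * f * 2 ^ (β.1 : ℕ) / Λ.Nmod)
        else Real.cos (2 * π * f * 2 ^ (β.1 : ℕ) / Λ.Nmod))) / 2) := by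
  rw [← Λ.card_block hB β, ← nsmul_eq_mul, ← sum_const]
  refine sum_congr rfl fun j hj => ?_
  obtain ⟨hl, hs⟩ := (mem_filter.1 hj).2
  rw [wt, hs, hl, testWeight]
  simp

/-- `Accurate f γ`: in every block the count is within `B/16` of its mean at frequency `f`. [cite: Kitaev1995, §3 (before Lemma 9)] -/
def Accurate (f : ℕ) (γ : QReg Λ.k) : Prop := ∀ β : Λ.Blk, |(Λ.cnt β γ : ℝ) - ∑ j ∈ Λ.block β, Λ.wt f j true| < Λ.B / 16

/-- **Accurate read-outs localise every level.** [cite: Kitaev1995, §3 Lemma 10] -/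
theorem cdist_levelEst_le (hB : 0 < Λ.B) {f : ℕ} {γ : QReg Λ.k} (hacc : Λ.Accurate f γ) (l : Fin Λ.kap) :
    cdist (Λ.levelEst γ l) (2 ^ (l : ℕ) * ((f : ℚ) / Λ.Nmod)) ≤ 5 / 32 := by
  have hcos := hacc (l, false)
  have hsin := hacc (l, true)
  rw [Λ.sum_wt_block hB] at hcos hsin
  simp only [if_true, Bool.false_eq_true, if_false] at hcos hsin
  set θ : ℝ := 2 * π * f * 2 ^ (l : ℕ) / Λ.Nmod with hθ
  obtain ⟨hc1, hc2⟩ := trigEst_of_cnt (c₀ := Real.cos θ) hB hcos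
  obtain ⟨hs1, hs2⟩ := trigEst_of_cnt (c₀ := Real.sin θ) hB hsin
  have hθ' : 2 * π * (((2 ^ (l : ℕ) * ((f : ℚ) / Λ.Nmod) : ℚ)) : ℝ) = θ := by rw [hθ]; push_cast; ring
  unfold levelEst
  refine cdist_quadrantCenter_le_bool hc2 hs2 ?_ ?_
  · rw [hθ']; exact hc1
  · rw [hθ']; exact hs1

/-- **Accurate read-outs estimate the eigenphase to within `(5/32)/2^{κ−1} = 5/(16N)`.** [cite: Kitaev1995, §3 Lemma 10] -/
theorem cdist_phaseEst_le (hB : 0 < Λ.B) {f : ℕ} {γ : QReg Λ.k} (hacc : Λ.Accurate f γ) :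
    cdist (Λ.phaseEst γ) ((f : ℚ) / Λ.Nmod) ≤ 5 / 32 / 2 ^ (Λ.kap - 1) := by
  unfold phaseEst
  refine cdist_refined_le (by unfold kap; omega) fun l hl => ?_
  rw [dif_pos hl]
  exact Λ.cdist_levelEst_le hB hacc ⟨l, hl⟩

/-- **An accurate read-out decodes to the frequency.** [cite: Kitaev1995, §3 Thm 1] -/
theorem freqOf_eq (hB : 0 < Λ.B) {f : ℕ} (hf : f < Λ.Nmod) {γ : QReg Λ.k} (hacc : Λ.Accurate f γ) : Λ.freqOf γ = f := by
  have h8 := Λ.size_facts.1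
  have hN : (0 : ℚ) < Λ.Nmod := by exact_mod_cast (show 0 < Λ.Nmod by omega)
  have hprec := Λ.cdist_phaseEst_le hB hacc
  -- `5/32/2^(κ-1) = 5/(16 N)`
  have hpow : (2 : ℚ) ^ (Λ.kap - 1) = Λ.Nmod / 2 := by
    rw [Nmod, Nat.cast_pow, Nat.cast_two, eq_div_iff (by norm_num), ← pow_succ, Nat.sub_add_cancel (by unfold kap; omega)]
  rw [hpow] at hprec
  unfold cdist at hprec
  set m : ℤ := round (Λ.phaseEst γ - (f : ℚ) / Λ.Nmod) with hm
  have hδ : |(Λ.Nmod : ℚ) * Λ.phaseEst γ - (f + m * Λ.Nmod)| ≤ 5 / 16 := by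
    have : (Λ.Nmod : ℚ) * Λ.phaseEst γ - (f + m * Λ.Nmod) = Λ.Nmod * (Λ.phaseEst γ - f / Λ.Nmod - m) := by field_simp; ring
    rw [this, abs_mul, abs_of_pos hN]
    calc (Λ.Nmod : ℚ) * |Λ.phaseEst γ - f / Λ.Nmod - m| ≤ Λ.Nmod * (5 / 32 / (Λ.Nmod / 2)) := mul_le_mul_of_nonneg_left hprec hN.le
      _ = 5 / 16 := by field_simp; ring
  have hround : round ((Λ.Nmod : ℚ) * Λ.phaseEst γ) = f + m * Λ.Nmod := by
    rw [round_eq, Int.floor_eq_iff]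
    rw [abs_le] at hδ
    push_cast
    constructor <;> linarith [hδ.1, hδ.2]
  unfold freqOf
  rw [hround, Int.add_mul_emod_self_right, Int.emod_eq_of_lt (by positivity) (by exact_mod_cast hf), Int.toNat_natCast]

/-! ### Accurate read-outs are likely -/

/-- There are `2κ` blocks. [folklore] -/
theorem card_Blk : Fintype.card Λ.Blk = 2 * Λ.kap := by
  rw [Fintype.card_prod, Fintype.card_fin, Fintype.card_bool, mul_comm]

open scoped Classical in
/-- **Inaccurate read-outs are rare**: total weight `≤ 128 κ / B` at every frequency (Chebyshev per
block, union over the `2κ` blocks). [cite: Kitaev1995, §3 (before Lemma 9)] -/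
theorem sum_not_accurate_le (hB : 0 < Λ.B) (f : ℕ) :
    ∑ γ ∈ univ.filter (fun γ => ¬ Λ.Accurate f γ), ∏ j, Λ.wt f j (γ j) ≤ 128 * Λ.kap / Λ.B := by
  have hBr : (0 : ℝ) < Λ.B := by exact_mod_cast hB
  have hsub : (univ.filter fun γ => ¬ Λ.Accurate f γ) =
      univ.filter fun γ : QReg Λ.k => ∃ β : Λ.Blk, (Λ.B : ℝ) / 16 ≤ |(Λ.cnt β γ : ℝ) - ∑ j ∈ Λ.block β, Λ.wt f j true| := by
    refine filter_congr fun γ _ => ?_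
    simp only [Accurate, not_forall, not_lt]
  rw [hsub]
  refine (sum_filter_exists_le _ (fun γ => prod_nonneg fun j _ => Λ.wt_nonneg f j _) _).trans ?_
  have hblock : ∀ β : Λ.Blk, ∑ γ ∈ univ.filter (fun γ : QReg Λ.k =>
      (Λ.B : ℝ) / 16 ≤ |(Λ.cnt β γ : ℝ) - ∑ j ∈ Λ.block β, Λ.wt f j true|), ∏ j, Λ.wt f j (γ j) ≤ 64 / Λ.B := by
    intro β
    have h := chebyshev_block (Λ.wt f) (Λ.wt_nonneg f) (Λ.wt_false_add_true f) (Λ.block β) (a := (Λ.B : ℝ) / 16) (by positivity)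
    rw [Λ.card_block hB] at h
    refine (le_of_eq rfl).trans (h.trans (le_of_eq ?_))
    field_simp; ring
  calc ∑ β : Λ.Blk, ∑ γ ∈ univ.filter (fun γ : QReg Λ.k =>
        (Λ.B : ℝ) / 16 ≤ |(Λ.cnt β γ : ℝ) - ∑ j ∈ Λ.block β, Λ.wt f j true|), ∏ j, Λ.wt f j (γ j)
      ≤ ∑ _β : Λ.Blk, (64 : ℝ) / Λ.B := sum_le_sum fun β _ => hblock β
    _ = (2 * Λ.kap : ℕ) * ((64 : ℝ) / Λ.B) := by rw [sum_const, card_univ, Λ.card_Blk, nsmul_eq_mul]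
    _ = 128 * Λ.kap / Λ.B := by push_cast; ring

/-- **The decoder is reliable in law**: at frequency `f < N`, the weight of the read-outs whose
decoded frequency satisfies `P` is `[P f]` up to `128 κ / B`. [cite: Kitaev1995, §3 Thm 1] -/
theorem abs_sum_decode_sub_le (hB : 0 < Λ.B) {f : ℕ} (hf : f < Λ.Nmod) (P : ℕ → Prop) [DecidablePred P] :
    |(∑ γ : QReg Λ.k, if P (Λ.freqOf γ) then ∏ j, Λ.wt f j (γ j) else 0) - (if P f then 1 else 0)| ≤ 128 * Λ.kap / Λ.B := by
  classical
  set Wt : QReg Λ.k → ℝ := fun γ => ∏ j, Λ.wt f j (γ j) with hWt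
  have hW0 : ∀ γ, 0 ≤ Wt γ := fun γ => prod_nonneg fun j _ => Λ.wt_nonneg f j _
  have htot : ∑ γ, Wt γ = 1 := sum_prodWeight (Λ.wt f) (Λ.wt_false_add_true f)
  have hbad := Λ.sum_not_accurate_le hB f
  rw [← sum_filter_add_sum_filter_not univ (fun γ => Λ.Accurate f γ)] at htot
  set Sbad := ∑ γ ∈ univ.filter (fun γ => ¬ Λ.Accurate f γ), Wt γ with hSbad
  have hSbad0 : 0 ≤ Sbad := sum_nonneg fun γ _ => hW0 γ
  -- split the decoded sum along `Accurate`
  rw [← sum_filter_add_sum_filter_not univ (fun γ => Λ.Accurate f γ)]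
  have hacc : ∑ γ ∈ univ.filter (fun γ => Λ.Accurate f γ), (if P (Λ.freqOf γ) then Wt γ else 0) =
      (if P f then 1 else 0) * ∑ γ ∈ univ.filter (fun γ => Λ.Accurate f γ), Wt γ := by
    rw [Finset.mul_sum]
    refine sum_congr rfl fun γ hγ => ?_
    rw [Λ.freqOf_eq hB hf (mem_filter.1 hγ).2]
    split_ifs <;> simp
  have hrest0 : 0 ≤ ∑ γ ∈ univ.filter (fun γ => ¬ Λ.Accurate f γ), (if P (Λ.freqOf γ) then Wt γ else 0) :=
    sum_nonneg fun γ _ => by split_ifs <;> [exact hW0 γ; exact le_rfl]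
  have hrest1 : ∑ γ ∈ univ.filter (fun γ => ¬ Λ.Accurate f γ), (if P (Λ.freqOf γ) then Wt γ else 0) ≤ Sbad :=
    sum_le_sum fun γ _ => by split_ifs <;> [exact le_rfl; exact hW0 γ]
  rw [hacc, show ∑ γ ∈ univ.filter (fun γ => Λ.Accurate f γ), Wt γ = 1 - Sbad by linarith, abs_le]
  constructor <;> split_ifs <;> nlinarith

end Layout


end CubicBlock

end VanDamSeroussi

end Literature.Computability.Cryptography
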